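/-
Copyright (c) 2026 the pub-hodgecm-mathlib formalisation cell (harness21).  Prover seat hodgecm-mathlib-K2Liu-p25 (g3), Track B «K2-LIT»,
#184♮ = hLiu418 = `stmt-HodgeConjecture-24832`; #42S BLOCK D, row D-2, (σ-A) mini-road (LEAD F0P6-plan (g15) RULING M-160f ∕ BATCH #227): brick [A4] + the
(σ-C) COMPOSITE — Karel's regularised Whittaker functional on the line model and the seam slots `(Λ, hΛ, Φ, hWfun)` of ★ p863939 from a LINE WORD for the stage-B value.
THEOREMS ONLY (no `def`, no `instance`, no `notation`, no named-fact hypothesis, no `sorry`, default heartbeats).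
-/
import Summits.HodgeConjecture.HodgeConjecture.Theorems.K2LiuIncoherentRankOneBadPlaceLineModel     -- ★ p863939: `hbad_faces_of_lineModel` ((1+1) model, `hfibre` paid)
import Summits.HodgeConjecture.HodgeConjecture.Theorems.K2LiuRankOneStageBallEquivariance       -- ★ p863817: ball translation `setIntegral_primePowBall_conj_addChar_mul_comp_add`
import Summits.HodgeConjecture.HodgeConjecture.Theorems.K2LiuIncoherentRankOneBadPlaceSeam          -- ★ p863462∕p863521: the ball currency (`hVdef′`), §1 dictionary; brings ★ W1-fin §1 (model-free closer)
import HarnessLib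

-- buildfix G11b-3 recipe (LEDGER B13-1/B13-3), as in the GelbartRogawski1991 siblings: elaborate sequentially.
set_option Elab.async false

/-!
# Crux `HLiu418`, #42S BLOCK D, row D-2 — (σ-C) COMPOSITE: the `hV` letter of ★ p863475 from ONE LINE WORD `N₂val(x) = γ · ∫ leviOpPi a (unipOpPi (x • c_τ) Φ_line)`
# on the BALL road (Ψ-free, no functional, no stability); and Karel's regularised functional `(Λ, hΛ)` for the functional road (from ball stability)

Cell `hodgecm-mathlib`, crux item hLiu418 = `stmt-HodgeConjecture-24832` (helper lane `--supports … --as helper`, count-neutral; closes no socket); squad K2 ∕ K2Liu (L1).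
Prover K2Liu-p25 (g3) = (σ-A) road desk + pen of [A4]∕(σ-C) (RULING M-160f); block-D desk K2Liu-p12 (g6); box K2Liu-audit1 (g3).

THE COMPOSITE.  Both D-2 roads need ONE analytic input from the (σ-A) mini-road: the LINE WORD `hword : N₂val X j h i v x = γ · ∫ (leviOpPi a (unipOpPi (x • c_τ(X,v)) Φl)) dμ_v^{1+1}`
(the stages of the SW section of a pure tensor along `V′_v = V₁ ⊕ H` collapse to Rao's word of a LINE vector `Φl`; bricks [A1]–[A4], BY VALUE here).
* §3 (THE COMPOSITE OF RECORD, ball road) **`hV_faces_of_lineWord`** — ★ p863475's `hV` binder (its D-2 group `cW V hWfac hV`) from the ball currency `hVdef′` of ★ p863521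
  (`V k = ∫_{𝔭^{−k}} conj ψ_v(σc x)·N₂val x dμ_v`), `hword`, the (1+1) datum `(T, E″, τ)`, `σc ≠ 0` and the CLASS letter `hclass : dead ⇒ ((−σc)·(a_v·im τ)⁻¹, θ)_v = −1`:
  ★ W1-fin §1 `exists_forall_setIntegral_word_mul_addChar_eq_zero` is MODEL-FREE and its support letter holds for EVERY `y` by ★ p863790 §4 — so NO `hΨ`, NO functional,
  NO ball-stability letter; D-2's by-value residue becomes `{hword} ∪ {T τ E″ σc hσ hclass}`.
* §1–§2 (the functional road's slots, kept for ★ p863715 ∘ ★ p863939): **`exists_functional_of_ballStable`** — from a linear family `V : 𝒮(X) → (F → ℂ)` with the translation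
  law `V (M z g) x = V g (x + z)`, local integrability and BALL STABILITY, a LINEAR functional `Λ` with the eventual ball value and `Λ (M z g) = ψ(σ z) · Λ g` (★ p863817's
  translation of balls) — Karel's regularised Whittaker functional, abstractly; **`exists_lineFunctional`** — the same for the concrete word `V g x = γ · ∫ (unipOpPi (x • c) g) dμ^ι`
  (translation law from ★ `unipOpPi_add`, local integrability by dominated convergence), only ball stability ([A5]) by value.
[KudlaRallis1994, §2–§3] [CasselmanShalika1980, §2] [Rangarao1993, Lemma 3.2 (3.8)] [MoeglinVignerasWaldspurger1987, Chap. 2 II.6].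
HONEST LABEL.  Measure-theoretic bookkeeping; count-neutral helper; `HC_CM` is proved only modulo the 7 printed citations (2 remaining named inputs:
hLiu418 = `stmt-HodgeConjecture-24832`, h413 = `stmt-HodgeConjecture-24833`) until rung 0 closes.  NOT here: `hword` ([A1]–[A4]); `hstab` ([A5], functional road only).

## References
* [KudlaRallis1994] S. Kudla, S. Rallis, Ann. of Math. 140 (1994), §2–§3.
* [CasselmanShalika1980] W. Casselman, J. Shalika, Compositio Math. 41 (1980), §2.
* [Rangarao1993] R. Ranga Rao, Pacific J. Math. 157 (1993), Lemma 3.2 (3.8) p. 351.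
* [MoeglinVignerasWaldspurger1987] C. Mœglin, M.-F. Vignéras, J.-L. Waldspurger, LNM 1291 (1987), Chap. 2 II.6.
-/

set_option autoImplicit false
set_option linter.dupNamespace false -- the mandated namespace repeats `HodgeConjecture.HodgeConjecture`

noncomputable section

open scoped Matrix ComplexConjugate
open NumberField IsDedekindDomain Matrix MeasureTheory Set Filter
open Literature.RepresentationTheory.HeisenbergGroup Literature.RepresentationTheory.HeisenbergGroup.SymplecticMatrix
open Literature.NumberTheory.QuadraticForms Literature.NumberTheory.Automorphic Literature.NumberTheory.Automorphic.UnitaryGroup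
open Literature.NumberTheory.Automorphic.UnitaryGroup.QuadraticCoordinates
open Literature.NumberTheory.GaloisRepresentations Literature.NumberTheory.GaloisRepresentations.IsNonarchimedeanLocalField
open Literature.NumberTheory.GelbartRogawski1991 Literature.NumberTheory.GelbartRogawski1991.GRConstruction
open Literature.NumberTheory.GelbartRogawski1991.UnitaryDualPair Literature.NumberTheory.GelbartRogawski1991.UnitaryDualPair.LocalSplitting
open Literature.NumberTheory.GelbartRogawski1991.AdaptedBlocks
open Summit.HodgeConjecture.HodgeConjecture.Cruxes.HLiu418.K2LiuRankOneStageBallEquivariance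

namespace Summit.HodgeConjecture.HodgeConjecture.Cruxes.HLiu418.K2LiuIncoherentRankOneBadPlaceSeamComposite

open K2LiuSiegelUnipotentFourierDefs
open K2LiuIncoherentRankOneBadPlaceLineModel (hbad_faces_of_lineModel halfForm_smul_left)

/-! ## §1 Karel's regularised Whittaker functional, abstractly: a linear functional from a ball-stable, translation-covariant family -/

section Abstract

variable {F : Type*} [Field F] [ValuativeRel F] [TopologicalSpace F] [IsNonarchimedeanLocalField F]
  [MeasurableSpace F] [BorelSpace F] (μ : Measure F) [μ.IsAddHaarMeasure]
  {X : Type*} [TopologicalSpace X]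

/-- **KAREL'S REGULARISED FUNCTIONAL.**  `ψ` an additive character, `σ ∈ F`, `M : F → End 𝒮(X)` a family of operators, `V : 𝒮(X) →ₗ (F → ℂ)` linear with the TRANSLATION LAW
`V (M z g) x = V g (x + z)`, locally integrable against `conj ψ(σ·)` on the balls `𝔭^{−k}`, and BALL-STABLE (`∫_{𝔭^{−k}} conj ψ(σx)·V g x` constant for `k ≥ k₀(g)`).  Then there is a
LINEAR functional `Λ` on `𝒮(X)` whose value at `g` is that eventual ball integral, and **`Λ (M z g) = ψ(σ z) · Λ g`** (quasi-invariance: translate the ball by `z`, ★ p863817).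
[cite: CasselmanShalika1980, §2] [cite: KudlaRallis1994, §2–§3] -/
theorem exists_functional_of_ballStable (ψ : AddChar F Circle) (σ : F)
    (M : F → (↥(SchwartzBruhat X) →ₗ[ℂ] ↥(SchwartzBruhat X))) (V : ↥(SchwartzBruhat X) →ₗ[ℂ] (F → ℂ))
    (hVtrans : ∀ (z : F) (g : ↥(SchwartzBruhat X)) (x : F), V (M z g) x = V g (x + z))
    (hVint : ∀ (g : ↥(SchwartzBruhat X)) (k : ℕ), IntegrableOn (fun x => conj ((ψ (σ * x) : ℂ)) * V g x) (primePowBall F (-(k : ℤ))) μ)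
    (hstab : ∀ g : ↥(SchwartzBruhat X), ∃ k₀ : ℕ, ∀ k : ℕ, k₀ ≤ k →
      ∫ x in primePowBall F (-(k : ℤ)), conj ((ψ (σ * x) : ℂ)) * V g x ∂μ = ∫ x in primePowBall F (-(k₀ : ℤ)), conj ((ψ (σ * x) : ℂ)) * V g x ∂μ) :
    ∃ Λ : ↥(SchwartzBruhat X) →ₗ[ℂ] ℂ,
      (∀ (z : F) (g : ↥(SchwartzBruhat X)), Λ (M z g) = ((ψ (σ * z) : Circle) : ℂ) • Λ g) ∧
      (∀ g : ↥(SchwartzBruhat X), ∃ k₀ : ℕ, ∀ k : ℕ, k₀ ≤ k →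
        Λ g = ∫ x in primePowBall F (-(k : ℤ)), conj ((ψ (σ * x) : ℂ)) * V g x ∂μ) := by
  classical
  choose K hK using hstab
  -- the ball integrals and their eventual constancy
  set I : ↥(SchwartzBruhat X) → ℕ → ℂ := fun g k => ∫ x in primePowBall F (-(k : ℤ)), conj ((ψ (σ * x) : ℂ)) * V g x ∂μ with hI
  have hev : ∀ g (k k' : ℕ), K g ≤ k → K g ≤ k' → I g k = I g k' := fun g k k' hk hk' => by
    change ∫ x in primePowBall F (-(k : ℤ)), _ ∂μ = ∫ x in primePowBall F (-(k' : ℤ)), _ ∂μ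
    rw [hK g k hk, hK g k' hk']
  refine ⟨{ toFun := fun g => I g (K g), map_add' := fun g g' => ?_, map_smul' := fun r g => ?_ }, fun z g => ?_, fun g => ⟨K g, fun k hk => ?_⟩⟩
  · -- additivity at a common large ball
    set k : ℕ := max (K (g + g')) (max (K g) (K g')) with hk
    rw [hev (g + g') (K (g + g')) k le_rfl (le_max_left _ _), hev g (K g) k le_rfl ((le_max_left _ _).trans (le_max_right _ _)),
      hev g' (K g') k le_rfl ((le_max_right _ _).trans (le_max_right _ _))]
    change ∫ x in primePowBall F (-(k : ℤ)), conj ((ψ (σ * x) : ℂ)) * V (g + g') x ∂μ =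
      (∫ x in primePowBall F (-(k : ℤ)), conj ((ψ (σ * x) : ℂ)) * V g x ∂μ) + ∫ x in primePowBall F (-(k : ℤ)), conj ((ψ (σ * x) : ℂ)) * V g' x ∂μ
    rw [← integral_add (hVint g k) (hVint g' k)]
    refine integral_congr_ae (Eventually.of_forall fun x => ?_)
    simp only [map_add, Pi.add_apply, mul_add]
  · -- homogeneity
    set k : ℕ := max (K (r • g)) (K g) with hk
    rw [hev (r • g) (K (r • g)) k le_rfl (le_max_left _ _), hev g (K g) k le_rfl (le_max_right _ _)]
    change ∫ x in primePowBall F (-(k : ℤ)), conj ((ψ (σ * x) : ℂ)) * V (r • g) x ∂μ =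
      r • ∫ x in primePowBall F (-(k : ℤ)), conj ((ψ (σ * x) : ℂ)) * V g x ∂μ
    rw [smul_eq_mul, ← integral_const_mul]
    refine integral_congr_ae (Eventually.of_forall fun x => ?_)
    simp only [map_smul, Pi.smul_apply, smul_eq_mul]
    ring
  · -- quasi-invariance: translate the ball by `z`
    obtain ⟨k₃, hk₃⟩ := exists_nat_mem_primePowBall_neg (F := F) z
    set k : ℕ := max (K (M z g)) (max (K g) k₃) with hk
    have hzk : z ∈ primePowBall F (-(k : ℤ)) :=
      primePowBall_antitone (neg_le_neg (Nat.cast_le.2 ((le_max_right _ _).trans (le_max_right _ _)))) hk₃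
    change I (M z g) (K (M z g)) = ((ψ (σ * z) : Circle) : ℂ) • I g (K g)
    rw [hev (M z g) (K (M z g)) k le_rfl (le_max_left _ _), hev g (K g) k le_rfl ((le_max_left _ _).trans (le_max_right _ _)), smul_eq_mul]
    change ∫ x in primePowBall F (-(k : ℤ)), conj ((ψ (σ * x) : ℂ)) * V (M z g) x ∂μ =
      ((ψ (σ * z) : Circle) : ℂ) * ∫ x in primePowBall F (-(k : ℤ)), conj ((ψ (σ * x) : ℂ)) * V g x ∂μ
    simp_rw [hVtrans z g]
    exact setIntegral_primePowBall_conj_addChar_mul_comp_add μ ψ σ (-(k : ℤ)) hzk (V g)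
  · -- the value
    change I g (K g) = I g k
    exact hev g (K g) k le_rfl hk

end Abstract

/-! ## §2 The concrete line word `V g x = γ · ∫ (unipOpPi (x • c) g) dμ^ι`: translation law and local integrability; `Λ` from ball stability -/

section LineWord

variable {F : Type*} [Field F] [ValuativeRel F] [TopologicalSpace F] [IsNonarchimedeanLocalField F]
  [MeasurableSpace F] [BorelSpace F] (μ : Measure F) [μ.IsAddHaarMeasure] [Invertible (2 : F)]
  {ι : Type*} [Fintype ι] {ψ : AddChar F Circle} (hψ : ψ.IsContinuousNontrivial)

include hψ in
/-- the line word is CONTINUOUS in the unipotent parameter: `x ↦ ∫ (unipOpPi (x • c) g) dμ^ι = ∫_y ψ(−x·halfForm c y)·g(y)` (dominated convergence, bound `|g|`).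
[cite: Rangarao1993, Lemma 3.2 (3.8) p. 351] -/
theorem continuous_integral_unipOpPi_smul (c : (ι → F) →ₗ[F] (ι → F)) (g : ↥(SchwartzBruhat (ι → F))) :
    Continuous fun x : F =>
      ∫ y, ((unipOpPi (isLocallyConstant_of_isContinuousNontrivial hψ) (x • c) g : ↥(SchwartzBruhat (ι → F))) : (ι → F) → ℂ) y
        ∂(Measure.pi fun _ : ι => μ) := by
  haveI : T2Space F := (IsNonarchimedeanLocalField.isLocalField F).toT2Space
  haveI := secondCountableTopology_localField F
  have hgi : Integrable ((g : ↥(SchwartzBruhat (ι → F))) : (ι → F) → ℂ) (Measure.pi fun _ : ι => μ) :=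
    Literature.RepresentationTheory.HeisenbergGroup.integrable_of_mem_schwartzBruhat _ g.2
  refine continuous_of_dominated (bound := fun y => ‖((g : ↥(SchwartzBruhat (ι → F))) : (ι → F) → ℂ) y‖) (fun x => ?_) (fun x => ?_) hgi.norm ?_
  · exact (unipOpPi (isLocallyConstant_of_isContinuousNontrivial hψ) (x • c) g).2.1.continuous.aestronglyMeasurable
  · refine Eventually.of_forall fun y => ?_
    rw [coe_unipOpPi_apply, norm_mul, Circle.norm_coe, one_mul]
  · refine Eventually.of_forall fun y => ?_
    simp only [coe_unipOpPi_apply, halfForm_smul_left]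
    exact (continuous_subtype_val.comp (hψ.1.comp ((continuous_id.mul continuous_const).neg))).mul continuous_const

include hψ in
/-- the line word is locally integrable against `conj ψ(σ·)`: `x ↦ conj ψ(σx) · (γ · ∫ (unipOpPi (x • c) g) dμ^ι)` is integrable on every ball `𝔭^{−k}` (continuous on a compact).
[cite: Tate1950, §2.2] -/
theorem integrableOn_conj_addChar_mul_lineWord (c : (ι → F) →ₗ[F] (ι → F)) (γ : ℂ) (σ : F) (g : ↥(SchwartzBruhat (ι → F))) (k : ℤ) :
    IntegrableOn (fun x : F => conj ((ψ (σ * x) : ℂ)) *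
      (γ * ∫ y, ((unipOpPi (isLocallyConstant_of_isContinuousNontrivial hψ) (x • c) g : ↥(SchwartzBruhat (ι → F))) : (ι → F) → ℂ) y
        ∂(Measure.pi fun _ : ι => μ))) (primePowBall F k) μ := by
  haveI : T2Space F := (IsNonarchimedeanLocalField.isLocalField F).toT2Space
  have hc : Continuous fun x : F => conj ((ψ (σ * x) : ℂ)) *
      (γ * ∫ y, ((unipOpPi (isLocallyConstant_of_isContinuousNontrivial hψ) (x • c) g : ↥(SchwartzBruhat (ι → F))) : (ι → F) → ℂ) y
        ∂(Measure.pi fun _ : ι => μ)) :=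
    (Complex.continuous_conj.comp (continuous_subtype_val.comp (hψ.1.comp (continuous_const.mul continuous_id)))).mul
      (continuous_const.mul (continuous_integral_unipOpPi_smul μ hψ c g))
  exact hc.continuousOn.integrableOn_compact (isCompact_primePowBall _)

include hψ in
/-- the line word is ADDITIVE in the test vector. [cite: Rangarao1993, Lemma 3.2 (3.8) p. 351] -/
theorem lineWord_add (c : (ι → F) →ₗ[F] (ι → F)) (x : F) (g g' : ↥(SchwartzBruhat (ι → F))) :
    ∫ y, ((unipOpPi (isLocallyConstant_of_isContinuousNontrivial hψ) (x • c) (g + g') : ↥(SchwartzBruhat (ι → F))) : (ι → F) → ℂ) y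
        ∂(Measure.pi fun _ : ι => μ) =
      (∫ y, ((unipOpPi (isLocallyConstant_of_isContinuousNontrivial hψ) (x • c) g : ↥(SchwartzBruhat (ι → F))) : (ι → F) → ℂ) y
        ∂(Measure.pi fun _ : ι => μ)) +
      ∫ y, ((unipOpPi (isLocallyConstant_of_isContinuousNontrivial hψ) (x • c) g' : ↥(SchwartzBruhat (ι → F))) : (ι → F) → ℂ) y
        ∂(Measure.pi fun _ : ι => μ) := by
  haveI := secondCountableTopology_localField F
  have hi : ∀ f : ↥(SchwartzBruhat (ι → F)), Integrable ((f : ↥(SchwartzBruhat (ι → F))) : (ι → F) → ℂ) (Measure.pi fun _ : ι => μ) :=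
    fun f => Literature.RepresentationTheory.HeisenbergGroup.integrable_of_mem_schwartzBruhat _ f.2
  rw [map_add, ← integral_add (hi _) (hi _)]
  rfl

omit [BorelSpace F] [μ.IsAddHaarMeasure] in
include hψ in
/-- the line word is HOMOGENEOUS in the test vector. [cite: Rangarao1993, Lemma 3.2 (3.8) p. 351] -/
theorem lineWord_smul (c : (ι → F) →ₗ[F] (ι → F)) (x : F) (r : ℂ) (g : ↥(SchwartzBruhat (ι → F))) :
    ∫ y, ((unipOpPi (isLocallyConstant_of_isContinuousNontrivial hψ) (x • c) (r • g) : ↥(SchwartzBruhat (ι → F))) : (ι → F) → ℂ) y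
        ∂(Measure.pi fun _ : ι => μ) =
      r * ∫ y, ((unipOpPi (isLocallyConstant_of_isContinuousNontrivial hψ) (x • c) g : ↥(SchwartzBruhat (ι → F))) : (ι → F) → ℂ) y
        ∂(Measure.pi fun _ : ι => μ) := by
  rw [map_smul, ← integral_const_mul]
  rfl

include hψ in
/-- **KAREL'S FUNCTIONAL FOR THE LINE WORD.**  For `c` a linear map (phase form `halfForm c`), `γ ∈ ℂ`, `σ ∈ F`: IF the ball integrals
`∫_{𝔭^{−k}} conj ψ(σx) · (γ·∫ (unipOpPi (x • c) g) dμ^ι) dμ` are eventually constant in `k` for every `g` (`hstab`, brick [A5]), THEN there is a LINEAR functional `Λ` on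
`𝒮(F^ι)` with that eventual value and **`Λ (unipOpPi (z • c) g) = ψ(σ z) · Λ g`** — the `(Λ, hΛ)` slots of ★ p863939 at `σ := β′`. [cite: CasselmanShalika1980, §2]
[cite: KudlaRallis1994, §2–§3] [cite: Rangarao1993, Lemma 3.2 (3.8) p. 351] -/
theorem exists_lineFunctional (c : (ι → F) →ₗ[F] (ι → F)) (γ : ℂ) (σ : F)
    (hstab : ∀ g : ↥(SchwartzBruhat (ι → F)), ∃ k₀ : ℕ, ∀ k : ℕ, k₀ ≤ k →
      ∫ x in primePowBall F (-(k : ℤ)), conj ((ψ (σ * x) : ℂ)) *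
          (γ * ∫ y, ((unipOpPi (isLocallyConstant_of_isContinuousNontrivial hψ) (x • c) g : ↥(SchwartzBruhat (ι → F))) : (ι → F) → ℂ) y
            ∂(Measure.pi fun _ : ι => μ)) ∂μ =
        ∫ x in primePowBall F (-(k₀ : ℤ)), conj ((ψ (σ * x) : ℂ)) *
          (γ * ∫ y, ((unipOpPi (isLocallyConstant_of_isContinuousNontrivial hψ) (x • c) g : ↥(SchwartzBruhat (ι → F))) : (ι → F) → ℂ) y
            ∂(Measure.pi fun _ : ι => μ)) ∂μ) :
    ∃ Λ : ↥(SchwartzBruhat (ι → F)) →ₗ[ℂ] ℂ,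
      (∀ (z : F) (g : ↥(SchwartzBruhat (ι → F))),
        Λ (unipOpPi (isLocallyConstant_of_isContinuousNontrivial hψ) (z • c) g) = ((ψ (σ * z) : Circle) : ℂ) • Λ g) ∧
      (∀ g : ↥(SchwartzBruhat (ι → F)), ∃ k₀ : ℕ, ∀ k : ℕ, k₀ ≤ k →
        Λ g = ∫ x in primePowBall F (-(k : ℤ)), conj ((ψ (σ * x) : ℂ)) *
          (γ * ∫ y, ((unipOpPi (isLocallyConstant_of_isContinuousNontrivial hψ) (x • c) g : ↥(SchwartzBruhat (ι → F))) : (ι → F) → ℂ) y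
            ∂(Measure.pi fun _ : ι => μ)) ∂μ) := by
  -- the word as a linear map `𝒮 →ₗ (F → ℂ)` (packaged opaquely with its defining equation)
  obtain ⟨V, hVapply⟩ : ∃ V : ↥(SchwartzBruhat (ι → F)) →ₗ[ℂ] (F → ℂ), ∀ (g : ↥(SchwartzBruhat (ι → F))) (x : F),
      V g x = γ * ∫ y, ((unipOpPi (isLocallyConstant_of_isContinuousNontrivial hψ) (x • c) g :
        ↥(SchwartzBruhat (ι → F))) : (ι → F) → ℂ) y ∂(Measure.pi fun _ : ι => μ) := by
    refine ⟨⟨⟨fun g x => γ * ∫ y, ((unipOpPi (isLocallyConstant_of_isContinuousNontrivial hψ) (x • c) g :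
        ↥(SchwartzBruhat (ι → F))) : (ι → F) → ℂ) y ∂(Measure.pi fun _ : ι => μ), fun g g' => ?_⟩, fun r g => ?_⟩, fun _ _ => rfl⟩
    · funext x
      change γ * _ = γ * _ + γ * _
      rw [lineWord_add μ hψ c x g g', mul_add]
    · funext x
      change γ * _ = r * (γ * _)
      rw [lineWord_smul μ hψ c x r g, mul_left_comm]
  have hVtrans : ∀ (z : F) (g : ↥(SchwartzBruhat (ι → F))) (x : F),
      V (((unipOpPi (isLocallyConstant_of_isContinuousNontrivial hψ) (z • c) : _ ≃ₗ[ℂ] _) : _ →ₗ[ℂ] _) g) x = V g (x + z) := by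
    intro z g x
    rw [hVapply, LinearEquiv.coe_coe, hVapply, add_smul, unipOpPi_add, LinearEquiv.mul_apply]
  have hVint : ∀ (g : ↥(SchwartzBruhat (ι → F))) (k : ℕ),
      IntegrableOn (fun x => conj ((ψ (σ * x) : ℂ)) * V g x) (primePowBall F (-(k : ℤ))) μ := by
    intro g k
    have hfun : (fun x => conj ((ψ (σ * x) : ℂ)) * V g x) = fun x => conj ((ψ (σ * x) : ℂ)) *
        (γ * ∫ y, ((unipOpPi (isLocallyConstant_of_isContinuousNontrivial hψ) (x • c) g : ↥(SchwartzBruhat (ι → F))) : (ι → F) → ℂ) y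
          ∂(Measure.pi fun _ : ι => μ)) := funext fun x => by rw [hVapply]
    rw [hfun]
    exact integrableOn_conj_addChar_mul_lineWord μ hψ c γ σ g (-(k : ℤ))
  have hstab' : ∀ g : ↥(SchwartzBruhat (ι → F)), ∃ k₀ : ℕ, ∀ k : ℕ, k₀ ≤ k →
      ∫ x in primePowBall F (-(k : ℤ)), conj ((ψ (σ * x) : ℂ)) * V g x ∂μ = ∫ x in primePowBall F (-(k₀ : ℤ)), conj ((ψ (σ * x) : ℂ)) * V g x ∂μ := by
    intro g
    simp_rw [hVapply]
    exact hstab g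
  obtain ⟨Λ, hΛ, hval⟩ := exists_functional_of_ballStable μ ψ σ
    (fun z => ((unipOpPi (isLocallyConstant_of_isContinuousNontrivial hψ) (z • c) : _ ≃ₗ[ℂ] _) : _ →ₗ[ℂ] _)) V hVtrans hVint hstab'
  refine ⟨Λ, fun z g => hΛ z g, fun g => ?_⟩
  obtain ⟨k₀, hk₀⟩ := hval g
  refine ⟨k₀, fun k hk => ?_⟩
  rw [hk₀ k hk]
  simp_rw [hVapply]

end LineWord

/-! ## §3 THE (σ-C) COMPOSITE ON THE BALL ROAD: ★ p863475's `hV` binder from the LINE WORD — no functional, no support letter, no stability -/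

section BallRoad

variable (L : Type) [Field L] [NumberField L] [IsCMField L]
variable {N M n : ℕ} (e : Fin N × Fin M ≃ Fin n)
  (dV : Fin N → L) (hdV : ∀ i, IsCMField.complexConj L (dV i) = dV i)
  (dW : Fin M → L) (hdW : ∀ i, IsCMField.complexConj L (dW i) = dW i)

variable {ι : skewMatrices ((IsCMField.complexConj L : L ≃ₐ[Fp L] L) : L →+* L) ((gramR L e dV hdV dW hdW).map (algebraMap (Fp L) L)) → Type}

variable [∀ v : HeightOneSpectrum (𝓞 ↥(maximalRealSubfield L)), MeasurableSpace (v.adicCompletion ↥(maximalRealSubfield L))]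
  [∀ v : HeightOneSpectrum (𝓞 ↥(maximalRealSubfield L)), BorelSpace (v.adicCompletion ↥(maximalRealSubfield L))]

open K2LiuIncoherentRankOneBadPlaceVanishingRow (exists_addSubgroupFamily_primePowBall)
open K2LiuIncoherentRankOneBadPlaceSeam (setIntegral_conj_addChar_mul_eq)
open K2LiuRankOneLocalSWWhittakerVanishing (exists_forall_setIntegral_word_mul_addChar_eq_zero)
open K2LiuIncoherentRankOneBadPlaceDichotomy (halfForm_cOfFix_mover_conj_nElem_ne_of_hilbertSymbol_cmQuadraticGenerator)

/-- **THE (σ-C) COMPOSITE OF RECORD — ROW D-2's `hV` LETTER FROM THE LINE WORD, Ψ-FREE.**  Frame `S₁ val I Tf V` (★ p863475's), the (1+1) doubled-line datum per place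
(`T v = (a_v)`, ANY `E″ v ∈ Sp(𝕎_v)`, skew `τ X v`), Haar measures `μ v`, the corner character scalars `σc X v ≠ 0` with their CLASS at dead places
`hclass : dead ⇒ ((−σc X v)·(a_v·im τ_X v)⁻¹, θ)_v = −1`, the ball currency `hVdef′` of ★ p863521 (`V X j h i v k = ∫_{𝔭^{−k}} conj ψ_v(σc x)·N₂val x dμ_v`), and the LINE WORD
`hword : N₂val X j h i v x = γ · ∫ (leviOpPi a (unipOpPi (x • c_τ(X,v)) Φl)) dμ_v^{1+1}` (bricks [A1]–[A4] of the (σ-A) mini-road; Rao's word of the line vector `Φl`)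
⟹ the `hV` binder of ★ p863475 `hdead_of_facePresentations_rows` BYTES: at a dead bad place the ball values vanish for all large `k` — by ★ W1-fin §1 (model-free closer)
whose support letter holds for EVERY `y` by ★ p863790 §4 (the (1+1) phase form misses `−σc X v`).  No functional `Λ`, no `hΨ`, no ball-stability letter.
[cite: KudlaRallis1994, §2] [cite: MoeglinVignerasWaldspurger1987, Chap. 2 II.6] [cite: Rangarao1993, Lemma 3.2 (3.8) p. 351] -/
theorem hV_faces_of_lineWord {φ : Type*}
    (S₁ : Finset (HeightOneSpectrum (𝓞 ↥(maximalRealSubfield L))))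
    (val : Matrix (Fin n) (Fin n) L → ↥(maximalRealSubfield L))
    (I : ∀ X : skewMatrices ((IsCMField.complexConj L : L ≃ₐ[Fp L] L) : L →+* L) ((gramR L e dV hdV dW hdW).map (algebraMap (Fp L) L)),
      ι X → HA L e dV hdV dW hdW → Finset φ)
    (Tf : ∀ X : skewMatrices ((IsCMField.complexConj L : L ≃ₐ[Fp L] L) : L →+* L) ((gramR L e dV hdV dW hdW).map (algebraMap (Fp L) L)),
      ι X → HA L e dV hdV dW hdW → Finset (HeightOneSpectrum (𝓞 ↥(maximalRealSubfield L))))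
    (V : ∀ X : skewMatrices ((IsCMField.complexConj L : L ≃ₐ[Fp L] L) : L →+* L) ((gramR L e dV hdV dW hdW).map (algebraMap (Fp L) L)),
      ι X → HA L e dV hdV dW hdW → φ → HeightOneSpectrum (𝓞 ↥(maximalRealSubfield L)) → ℕ → ℂ)
    -- the (1+1) doubled-line datum per place and the Haar measures
    (T : HeightOneSpectrum (𝓞 ↥(maximalRealSubfield L)) → Matrix (Fin 1) (Fin 1) ↥(maximalRealSubfield L)) (hTs : ∀ v, (T v).IsSymm)
    (E'' : ∀ v : HeightOneSpectrum (𝓞 ↥(maximalRealSubfield L)), LocalSp ↥(maximalRealSubfield L) (1 + 1) (gramD ↥(maximalRealSubfield L) 1 (T v)) v)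
    (μ : ∀ v : HeightOneSpectrum (𝓞 ↥(maximalRealSubfield L)), Measure (v.adicCompletion ↥(maximalRealSubfield L))) [∀ v, (μ v).IsAddHaarMeasure]
    (τ : skewMatrices ((IsCMField.complexConj L : L ≃ₐ[Fp L] L) : L →+* L) ((gramR L e dV hdV dW hdW).map (algebraMap (Fp L) L)) →
      ∀ v : HeightOneSpectrum (𝓞 ↥(maximalRealSubfield L)), LocalRing L v)
    (hτ : ∀ X v, conjLocal L (IsCMField.complexConj L) v (τ X v) = -τ X v)
    -- the corner character scalars and their class at dead places
    (σc : skewMatrices ((IsCMField.complexConj L : L ≃ₐ[Fp L] L) : L →+* L) ((gramR L e dV hdV dW hdW).map (algebraMap (Fp L) L)) →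
      ∀ v : HeightOneSpectrum (𝓞 ↥(maximalRealSubfield L)), v.adicCompletion ↥(maximalRealSubfield L))
    (hσ : ∀ X v, σc X v ≠ 0)
    (hclass : ∀ X : skewMatrices ((IsCMField.complexConj L : L ≃ₐ[Fp L] L) : L →+* L) ((gramR L e dV hdV dW hdW).map (algebraMap (Fp L) L)),
      (X : Matrix (Fin n) (Fin n) L) ≠ 0 → (X : Matrix (Fin n) (Fin n) L).det = 0 → ∀ (j : ι X) (h : HA L e dV hdV dW hdW), ∀ v ∈ Tf X j h,
      ¬ (hilbertSymbol (v.adicCompletion ↥(maximalRealSubfield L)) (algebraMap ↥(maximalRealSubfield L) _ (val X))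
          (algebraMap ↥(maximalRealSubfield L) _ (cmQuadraticGenerator L : ↥(maximalRealSubfield L))) = -1 ↔ v ∈ S₁) →
      hilbertSymbol (v.adicCompletion ↥(maximalRealSubfield L))
        (-σc X v * (algebraMap ↥(maximalRealSubfield L) (v.adicCompletion ↥(maximalRealSubfield L)) (T v 0 0) *
          im (quadraticLocalEquiv L v (IsCMField.complexConj L) (complexConj_imagUnit L) (imagUnit_ne_zero L)).toLinearEquiv.toAddEquiv (τ X v))⁻¹)
        (algebraMap ↥(maximalRealSubfield L) (v.adicCompletion ↥(maximalRealSubfield L)) (cmQuadraticGenerator L : ↥(maximalRealSubfield L))) = -1)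
    -- the LINE WORD data (outputs of [A1]–[A4]): Levi element, scalar, line vector, and the stage-B values it presents
    (a : ∀ X : skewMatrices ((IsCMField.complexConj L : L ≃ₐ[Fp L] L) : L →+* L) ((gramR L e dV hdV dW hdW).map (algebraMap (Fp L) L)),
      ι X → HA L e dV hdV dW hdW → φ → ∀ v : HeightOneSpectrum (𝓞 ↥(maximalRealSubfield L)),
        (Fin (1 + 1) → v.adicCompletion ↥(maximalRealSubfield L)) ≃ₗ[v.adicCompletion ↥(maximalRealSubfield L)] (Fin (1 + 1) → v.adicCompletion ↥(maximalRealSubfield L)))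
    (γ : ∀ X : skewMatrices ((IsCMField.complexConj L : L ≃ₐ[Fp L] L) : L →+* L) ((gramR L e dV hdV dW hdW).map (algebraMap (Fp L) L)),
      ι X → HA L e dV hdV dW hdW → φ → HeightOneSpectrum (𝓞 ↥(maximalRealSubfield L)) → ℂ)
    (Φl : ∀ X : skewMatrices ((IsCMField.complexConj L : L ≃ₐ[Fp L] L) : L →+* L) ((gramR L e dV hdV dW hdW).map (algebraMap (Fp L) L)),
      ι X → HA L e dV hdV dW hdW → φ → ∀ v : HeightOneSpectrum (𝓞 ↥(maximalRealSubfield L)),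
        ↥(SchwartzBruhat (Fin (1 + 1) → v.adicCompletion ↥(maximalRealSubfield L))))
    (N₂val : ∀ X : skewMatrices ((IsCMField.complexConj L : L ≃ₐ[Fp L] L) : L →+* L) ((gramR L e dV hdV dW hdW).map (algebraMap (Fp L) L)),
      ι X → HA L e dV hdV dW hdW → φ → ∀ v : HeightOneSpectrum (𝓞 ↥(maximalRealSubfield L)), v.adicCompletion ↥(maximalRealSubfield L) → ℂ)
    (hVdef' : ∀ X : skewMatrices ((IsCMField.complexConj L : L ≃ₐ[Fp L] L) : L →+* L) ((gramR L e dV hdV dW hdW).map (algebraMap (Fp L) L)),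
      (X : Matrix (Fin n) (Fin n) L) ≠ 0 → (X : Matrix (Fin n) (Fin n) L).det = 0 → ∀ (j : ι X) (h : HA L e dV hdV dW hdW), ∀ i ∈ I X j h, ∀ v ∈ Tf X j h, ∀ k : ℕ,
      V X j h i v k = ∫ x in primePowBall (v.adicCompletion (maximalRealSubfield L)) (-(k : ℤ)),
        conj ((((adeleAddCharAt (maximalRealSubfield L) v) (σc X v * x) : Circle) : ℂ)) * N₂val X j h i v x ∂(μ v))
    (hword : ∀ X : skewMatrices ((IsCMField.complexConj L : L ≃ₐ[Fp L] L) : L →+* L) ((gramR L e dV hdV dW hdW).map (algebraMap (Fp L) L)),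
      (X : Matrix (Fin n) (Fin n) L) ≠ 0 → (X : Matrix (Fin n) (Fin n) L).det = 0 → ∀ (j : ι X) (h : HA L e dV hdV dW hdW), ∀ i ∈ I X j h, ∀ v ∈ Tf X j h,
      ∀ x : v.adicCompletion ↥(maximalRealSubfield L),
      N₂val X j h i v x = γ X j h i v *
        ∫ y, ((leviOpPi (a X j h i v) (unipOpPi (isLocallyConstant_of_isContinuousNontrivial (isContinuousNontrivial_adeleAddCharAt ↥(maximalRealSubfield L) v))
          (x • Matrix.mulVecLin (cOfFix (localGram ↥(maximalRealSubfield L) (1 + 1) (gramD ↥(maximalRealSubfield L) 1 (T v)) v)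
            (E'' v * iotaD ↥(maximalRealSubfield L) L (IsCMField.complexConj L) (complexConj_imagUnit L) (imagUnit_ne_zero L) (imagUnit_mul_self L) v 1 (hTs v) rfl
              (nElem ↥(maximalRealSubfield L) L (IsCMField.complexConj L) v 1 rfl (τ X v • 1)
                (skew_smul_one ↥(maximalRealSubfield L) L (IsCMField.complexConj L) v 1 (τ X v) (hτ X v))) * (E'' v)⁻¹))) (Φl X j h i v)) :
          ↥(SchwartzBruhat (Fin (1 + 1) → v.adicCompletion ↥(maximalRealSubfield L)))) : (Fin (1 + 1) → v.adicCompletion ↥(maximalRealSubfield L)) → ℂ) y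
          ∂(Measure.pi fun _ : Fin (1 + 1) => μ v)) :
    ∀ X : skewMatrices ((IsCMField.complexConj L : L ≃ₐ[Fp L] L) : L →+* L) ((gramR L e dV hdV dW hdW).map (algebraMap (Fp L) L)),
      (X : Matrix (Fin n) (Fin n) L) ≠ 0 → (X : Matrix (Fin n) (Fin n) L).det = 0 → ∀ (j : ι X) (h : HA L e dV hdV dW hdW), ∀ i ∈ I X j h, ∀ v ∈ Tf X j h,
      ¬ (hilbertSymbol (v.adicCompletion ↥(maximalRealSubfield L)) (algebraMap ↥(maximalRealSubfield L) _ (val X))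
          (algebraMap ↥(maximalRealSubfield L) _ (cmQuadraticGenerator L : ↥(maximalRealSubfield L))) = -1 ↔ v ∈ S₁) →
      ∃ k₁ : ℕ, ∀ k, k₁ ≤ k → V X j h i v k = 0 := by
  intro X hX0 hdet j h i hi v hv hdead
  obtain ⟨Cs, hCs, hCo, hCc, hmono, hexh⟩ := exists_addSubgroupFamily_primePowBall (v.adicCompletion ↥(maximalRealSubfield L))
  -- the Ψ-free support letter at the dead place: the (1+1) phase form misses `−σc X v` EVERYWHERE (★ p863790 §4)
  have hfibre := halfForm_cOfFix_mover_conj_nElem_ne_of_hilbertSymbol_cmQuadraticGenerator L v (hTs v) (τ X v) (hτ X v) (E'' v) (-σc X v)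
    (neg_ne_zero.2 (hσ X v)) (hclass X hX0 hdet j h v hv hdead)
  -- ★ W1-fin §1, model-free, at the line word
  obtain ⟨k₁, hk₁⟩ := exists_forall_setIntegral_word_mul_addChar_eq_zero (μ v) (isContinuousNontrivial_adeleAddCharAt ↥(maximalRealSubfield L) v)
    (Φl X j h i v) (a X j h i v) _ (γ X j h i v) (-σc X v) (N₂val X j h i v) (fun b => hword X hX0 hdet j h i hi v hv b) Cs hCo hCc hmono hexh
    (fun y _ => hfibre y)
  refine ⟨k₁, fun k hk => ?_⟩
  rw [hVdef' X hX0 hdet j h i hi v hv k, ← hCs k,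
    setIntegral_conj_addChar_mul_eq (μ v) (adeleAddCharAt ↥(maximalRealSubfield L) v) (σc X v) _ (N₂val X j h i v) (N₂val X j h i v) 1 (fun x => (one_mul _).symm),
    hk₁ k hk, mul_zero]

end BallRoad

end Summit.HodgeConjecture.HodgeConjecture.Cruxes.HLiu418.K2LiuIncoherentRankOneBadPlaceSeamComposite

end
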